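import Mathlib
import Literature.Probability.LatticeModels.ThermodynamicLimit
import Literature.Probability.LatticeModels.SharpnessProofs
import HarnessLib

/-!
# Helpers (I) for stub `stub_levyContinuityTransfer` of line `diffusive-branch-is-nonsaturation`
(crux `PrecisionLaplacian.DirectCorrelationStableTail`, item stmt-CriticalPhenomena-4799)

**Bounds on the lattice symbol.**  For `m ∈ ℓ¹(ℤ³)` (`ℤ³ = Site 3`), nonnegative off the origin, the
rescaled symbol is `ψ_R(k) = R^α ∑_y m(y) (1 - cos(k·y/R))`.  This file proves:

* `levyCT_symbol_summable`, `levyCT_symbol_nonneg`, `levyCT_symbol_continuous`: absolute convergence,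
  nonnegativity (the origin term vanishes as `1 - cos 0 = 0`) and continuity in `k` (uniformly
  convergent series, Mathlib's `continuous_tsum`);
* `levyCT_symbol_le` (registered helper sub-goal `stub_levyContinuityTransfer_auxSymbolBound`): from
  tightness at infinity (`R^α ∑_{y ∈ T} m ≤ C` for finite `T ⊆ {‖y‖_∞ ≥ R}`, `R ≥ R₁`) and at the
  origin (`∑_{‖y‖_∞ ≤ R} m(y)|y|₂² ≤ C' R^{2-α}`), the quadratic-growth bound
  `ψ_R(k) ≤ (|C'|/2 + 2|C|)(1 + |k|₂²)` for `R ≥ max(R₁, 1)`: split the sum at `‖y‖_∞ = R`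
  (`Summable.sum_add_tsum_compl`), use `1 - cos t ≤ t²/2` and Cauchy–Schwarz inside the box and
  `1 - cos t ≤ 2` outside.

This is the domination needed for dominated convergence in the Lévy-continuity argument of the stub.
All statements are folklore (e.g. W. Feller, *An Introduction to Probability Theory and its
Applications* II (1971), XV.3–XV.4); no definitions are introduced.
-/

noncomputable section

namespace Summit.CriticalPhenomena.Ising3DConformalLimit.Cruxes.DirectCorrelationStableTail.DiffusiveBranchIsNonsaturation

open MeasureTheory Filter Topology
open scoped BigOperators
open Literature.Probability.LatticeModels

/-! ### The lattice symbol `ψ_R(k) = R^α ∑_y m(y) (1 - cos(k·y/R))` -/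

/-- The symbol summand `m(y)(1 - cos(k·y/R))` is absolutely summable for `m ∈ ℓ¹`. [folklore] -/
theorem levyCT_symbol_summable (m : Site 3 → ℝ) (hm : Summable m) (R : ℕ) (k : Fin 3 → ℝ) :
    Summable fun y : Site 3 => m y * (1 - Real.cos (∑ i, k i * ((y i : ℝ) / R))) := by
  refine Summable.of_norm_bounded (hm.abs.mul_left 2) (fun y => ?_)
  rw [Real.norm_eq_abs, abs_mul]
  have hd : |1 - Real.cos (∑ i, k i * ((y i : ℝ) / R))| ≤ 2 := by
    rw [abs_le]
    constructor <;>
      linarith [Real.cos_le_one (∑ i, k i * ((y i : ℝ) / R)),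
        Real.neg_one_le_cos (∑ i, k i * ((y i : ℝ) / R))]
  nlinarith [abs_nonneg (m y), abs_nonneg (1 - Real.cos (∑ i, k i * ((y i : ℝ) / R)))]

/-- The symbol summand is nonnegative termwise when `m ≥ 0` off the origin (the origin term
vanishes since `1 - cos 0 = 0`). [folklore] -/
theorem levyCT_symbol_term_nonneg (m : Site 3 → ℝ) (hnn : ∀ y, y ≠ 0 → 0 ≤ m y) (R : ℕ)
    (k : Fin 3 → ℝ) (y : Site 3) :
    0 ≤ m y * (1 - Real.cos (∑ i, k i * ((y i : ℝ) / R))) := by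
  by_cases hy : y = 0
  · subst hy
    simp
  · exact mul_nonneg (hnn y hy) (by linarith [Real.cos_le_one (∑ i, k i * ((y i : ℝ) / R))])

/-- **The symbol is nonnegative.** [folklore] -/
theorem levyCT_symbol_nonneg (m : Site 3 → ℝ) (hnn : ∀ y, y ≠ 0 → 0 ≤ m y) (α : ℝ) (R : ℕ)
    (k : Fin 3 → ℝ) :
    0 ≤ (R : ℝ) ^ α * ∑' y : Site 3, m y * (1 - Real.cos (∑ i, k i * ((y i : ℝ) / R))) :=
  mul_nonneg (Real.rpow_nonneg (Nat.cast_nonneg R) α)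
    (tsum_nonneg fun y => levyCT_symbol_term_nonneg m hnn R k y)

/-- **The symbol is continuous in `k`** (uniformly convergent series of continuous functions).
[folklore] -/
theorem levyCT_symbol_continuous (m : Site 3 → ℝ) (hm : Summable m) (α : ℝ) (R : ℕ) :
    Continuous fun k : Fin 3 → ℝ =>
      (R : ℝ) ^ α * ∑' y : Site 3, m y * (1 - Real.cos (∑ i, k i * ((y i : ℝ) / R))) := by
  refine continuous_const.mul ?_
  refine continuous_tsum (fun y => by fun_prop) (hm.abs.mul_left 2) (fun y k => ?_)
  rw [Real.norm_eq_abs, abs_mul]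
  have hd : |1 - Real.cos (∑ i, k i * ((y i : ℝ) / R))| ≤ 2 := by
    rw [abs_le]
    constructor <;>
      linarith [Real.cos_le_one (∑ i, k i * ((y i : ℝ) / R)),
        Real.neg_one_le_cos (∑ i, k i * ((y i : ℝ) / R))]
  nlinarith [abs_nonneg (m y), abs_nonneg (1 - Real.cos (∑ i, k i * ((y i : ℝ) / R)))]

/-- Pointwise quadratic bound on the symbol summand:
`m(y)(1 - cos(k·y/R)) ≤ (|k|₂²/(2R²)) · m(y)|y|₂²` (Cauchy–Schwarz and `1 - cos t ≤ t²/2`;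
the origin term is `0 ≤ 0`). [folklore] -/
theorem levyCT_symbol_term_le_sq (m : Site 3 → ℝ) (hnn : ∀ y, y ≠ 0 → 0 ≤ m y) {R : ℕ}
    (hR : 1 ≤ R) (k : Fin 3 → ℝ) (y : Site 3) :
    m y * (1 - Real.cos (∑ i, k i * ((y i : ℝ) / R))) ≤
      (∑ i, k i ^ 2) / (2 * (R : ℝ) ^ 2) * (m y * ∑ i, ((y i : ℝ)) ^ 2) := by
  have hRpos : (0 : ℝ) < R := by exact_mod_cast hR
  by_cases hy : y = 0
  · subst hy
    simp
  have hmy : 0 ≤ m y := hnn y hy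
  have h1 := Real.one_sub_sq_div_two_le_cos (x := ∑ i, k i * ((y i : ℝ) / R))
  have hcs : (∑ i, k i * ((y i : ℝ) / R)) ^ 2 ≤ (∑ i, k i ^ 2) * ∑ i, ((y i : ℝ) / R) ^ 2 :=
    Finset.sum_mul_sq_le_sq_mul_sq _ _ _
  have hdiv : ∑ i, ((y i : ℝ) / R) ^ 2 = (∑ i, ((y i : ℝ)) ^ 2) / (R : ℝ) ^ 2 := by
    rw [Finset.sum_div]
    exact Finset.sum_congr rfl fun i _ => by rw [div_pow]
  rw [hdiv] at hcs
  have hk : 0 ≤ ∑ i, k i ^ 2 := Finset.sum_nonneg fun i _ => sq_nonneg _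
  have hyy : 0 ≤ ∑ i, ((y i : ℝ)) ^ 2 := Finset.sum_nonneg fun i _ => sq_nonneg _
  have h2 : 1 - Real.cos (∑ i, k i * ((y i : ℝ) / R)) ≤
      (∑ i, k i ^ 2) * ((∑ i, ((y i : ℝ)) ^ 2) / (R : ℝ) ^ 2) / 2 := by linarith
  calc m y * (1 - Real.cos (∑ i, k i * ((y i : ℝ) / R)))
      ≤ m y * ((∑ i, k i ^ 2) * ((∑ i, ((y i : ℝ)) ^ 2) / (R : ℝ) ^ 2) / 2) :=
        mul_le_mul_of_nonneg_left h2 hmy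
    _ = (∑ i, k i ^ 2) / (2 * (R : ℝ) ^ 2) * (m y * ∑ i, ((y i : ℝ)) ^ 2) := by
        field_simp

/-- **Quadratic-growth bound on the symbol from tightness.**  If `m ∈ ℓ¹(ℤ³)` is nonnegative off
the origin, tight at infinity (`R^α ∑_{y ∈ T} m ≤ C` for finite `T ⊆ {‖y‖ ≥ R}`, `R ≥ R₁`) and at
the origin (`∑_{‖y‖ ≤ R} m(y)|y|₂² ≤ C' R^{2-α}`), then for `R ≥ max(R₁, 1)` and all `k`,
`ψ_R(k) = R^α ∑_y m(y)(1 - cos(k·y/R)) ≤ (|C'|/2 + 2|C|)(1 + |k|₂²)`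
(split the sum at `‖y‖ = R`: `1 - cos t ≤ t²/2` inside the box, `1 - cos t ≤ 2` outside).
[folklore] -/
theorem levyCT_symbol_le (m : Site 3 → ℝ) (α C C' : ℝ) (R₁ : ℕ) (hm : Summable m)
    (hnn : ∀ y, y ≠ 0 → 0 ≤ m y)
    (htail : ∀ R : ℕ, R₁ ≤ R → ∀ T : Finset (Site 3), (∀ y ∈ T, (R : ℝ) ≤ ‖y‖) →
      (R : ℝ) ^ α * ∑ y ∈ T, m y ≤ C)
    (hbox : ∀ R : ℕ, 1 ≤ R →
      ∑ y ∈ box 3 R, m y * (∑ i, ((y i : ℝ)) ^ 2) ≤ C' * (R : ℝ) ^ (2 - α))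
    (R : ℕ) (hR₁ : R₁ ≤ R) (hR : 1 ≤ R) (k : Fin 3 → ℝ) :
    (R : ℝ) ^ α * ∑' y : Site 3, m y * (1 - Real.cos (∑ i, k i * ((y i : ℝ) / R))) ≤
      (|C'| / 2 + 2 * |C|) * (1 + ∑ i, k i ^ 2) := by
  set F : Site 3 → ℝ := fun y => m y * (1 - Real.cos (∑ i, k i * ((y i : ℝ) / R))) with hF
  have hRpos : (0 : ℝ) < R := by exact_mod_cast hR
  have hRα : 0 < (R : ℝ) ^ α := Real.rpow_pos_of_pos hRpos α
  have hFs : Summable F := levyCT_symbol_summable m hm R k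
  have hk : 0 ≤ ∑ i, k i ^ 2 := Finset.sum_nonneg fun i _ => sq_nonneg _
  rw [← hFs.sum_add_tsum_compl (s := box 3 R), mul_add]
  -- the box part
  have hbox' : (R : ℝ) ^ α * ∑ y ∈ box 3 R, F y ≤ C' * (∑ i, k i ^ 2) / 2 := by
    have h1 : ∑ y ∈ box 3 R, F y ≤
        (∑ i, k i ^ 2) / (2 * (R : ℝ) ^ 2) * (C' * (R : ℝ) ^ (2 - α)) :=
      calc ∑ y ∈ box 3 R, F y
          ≤ ∑ y ∈ box 3 R, (∑ i, k i ^ 2) / (2 * (R : ℝ) ^ 2) * (m y * ∑ i, ((y i : ℝ)) ^ 2) :=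
            Finset.sum_le_sum fun y _ => levyCT_symbol_term_le_sq m hnn hR k y
        _ = (∑ i, k i ^ 2) / (2 * (R : ℝ) ^ 2) * ∑ y ∈ box 3 R, m y * ∑ i, ((y i : ℝ)) ^ 2 := by
            rw [Finset.mul_sum]
        _ ≤ (∑ i, k i ^ 2) / (2 * (R : ℝ) ^ 2) * (C' * (R : ℝ) ^ (2 - α)) :=
            mul_le_mul_of_nonneg_left (hbox R hR) (by positivity)
    have h2 : (R : ℝ) ^ α * ((∑ i, k i ^ 2) / (2 * (R : ℝ) ^ 2) * (C' * (R : ℝ) ^ (2 - α))) =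
        C' * (∑ i, k i ^ 2) / 2 := by
      have e : (R : ℝ) ^ α * (R : ℝ) ^ (2 - α) = (R : ℝ) ^ 2 := by
        rw [← Real.rpow_add hRpos, ← Real.rpow_two]
        ring_nf
      field_simp
      rw [← e]
      ring
    calc (R : ℝ) ^ α * ∑ y ∈ box 3 R, F y
        ≤ (R : ℝ) ^ α * ((∑ i, k i ^ 2) / (2 * (R : ℝ) ^ 2) * (C' * (R : ℝ) ^ (2 - α))) :=
          mul_le_mul_of_nonneg_left h1 hRα.le
      _ = C' * (∑ i, k i ^ 2) / 2 := h2
  -- the tail part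
  have htail' : (R : ℝ) ^ α * ∑' y : ((↑(box 3 R) : Set (Site 3))ᶜ : Set (Site 3)), F y ≤ 2 * C := by
    have hmsub : Summable fun y : ((↑(box 3 R) : Set (Site 3))ᶜ : Set (Site 3)) => m y :=
      hm.subtype _
    have hout : ∀ y : ((↑(box 3 R) : Set (Site 3))ᶜ : Set (Site 3)), (R : ℝ) ≤ ‖(y : Site 3)‖ := by
      intro y
      have hy : (y : Site 3) ∉ box 3 R := fun h => y.2 (Finset.mem_coe.2 h)
      rw [mem_box_iff_supNorm_le, not_le] at hy
      rw [Site.norm_eq_supNorm]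
      exact_mod_cast hy.le
    have hne : ∀ y : ((↑(box 3 R) : Set (Site 3))ᶜ : Set (Site 3)), (y : Site 3) ≠ 0 := by
      intro y h
      exact y.2 (Finset.mem_coe.2 (h ▸ zero_mem_box 3 R))
    have hFle : ∀ y : ((↑(box 3 R) : Set (Site 3))ᶜ : Set (Site 3)), F y ≤ 2 * m y := by
      intro y
      simp only [hF]
      have hmy : 0 ≤ m y := hnn _ (hne y)
      nlinarith [Real.neg_one_le_cos (∑ i, k i * (((y : Site 3) i : ℝ) / R))]
    have hsum_m : ∑' y : ((↑(box 3 R) : Set (Site 3))ᶜ : Set (Site 3)), m y ≤ C / (R : ℝ) ^ α := by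
      refine hmsub.tsum_le_of_sum_le fun S => ?_
      have hT := htail R hR₁ (S.map (Function.Embedding.subtype _)) (fun y hy => ?_)
      · rw [Finset.sum_map] at hT
        rw [le_div_iff₀ hRα, mul_comm]
        exact hT
      · obtain ⟨z, -, rfl⟩ := Finset.mem_map.1 hy
        exact hout z
    calc (R : ℝ) ^ α * ∑' y : ((↑(box 3 R) : Set (Site 3))ᶜ : Set (Site 3)), F y
        ≤ (R : ℝ) ^ α * ∑' y : ((↑(box 3 R) : Set (Site 3))ᶜ : Set (Site 3)), 2 * m y :=
          mul_le_mul_of_nonneg_left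
            ((hFs.subtype _).tsum_le_tsum hFle (hmsub.mul_left 2)) hRα.le
      _ = 2 * ((R : ℝ) ^ α * ∑' y : ((↑(box 3 R) : Set (Site 3))ᶜ : Set (Site 3)), m y) := by
          rw [tsum_mul_left]
          ring
      _ ≤ 2 * ((R : ℝ) ^ α * (C / (R : ℝ) ^ α)) := by gcongr
      _ = 2 * C := by field_simp
  -- conclusion
  have e1 : C' * (∑ i, k i ^ 2) / 2 ≤ |C'| / 2 * (1 + ∑ i, k i ^ 2) := by
    have : C' * (∑ i, k i ^ 2) ≤ |C'| * (∑ i, k i ^ 2) :=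
      mul_le_mul_of_nonneg_right (le_abs_self C') hk
    nlinarith [abs_nonneg C']
  have e2 : 2 * C ≤ 2 * |C| * (1 + ∑ i, k i ^ 2) := by
    nlinarith [le_abs_self C, abs_nonneg C]
  linarith

/-- **Registered helper sub-goal `stub_levyContinuityTransfer_auxSymbolBound`** of stub
`stub_levyContinuityTransfer` (line `diffusive-branch-is-nonsaturation`, crux
stmt-CriticalPhenomena-4799): the quadratic-growth bound on the lattice symbol from tightness,
`R^α ∑_y m(y)(1 - cos(k·y/R)) ≤ (|C'|/2 + 2|C|)(1 + |k|₂²)` for `R ≥ max(R₁,1)`. [folklore] -/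
theorem stub_levyContinuityTransfer_auxSymbolBound :
    ∀ (m : Site 3 → ℝ) (α C C' : ℝ) (R₁ : ℕ), Summable m → (∀ y, y ≠ 0 → 0 ≤ m y) →
      (∀ R : ℕ, R₁ ≤ R → ∀ T : Finset (Site 3), (∀ y ∈ T, (R : ℝ) ≤ ‖y‖) →
        (R : ℝ) ^ α * ∑ y ∈ T, m y ≤ C) →
      (∀ R : ℕ, 1 ≤ R → ∑ y ∈ box 3 R, m y * (∑ i, ((y i : ℝ)) ^ 2) ≤ C' * (R : ℝ) ^ (2 - α)) →
      ∀ R : ℕ, R₁ ≤ R → 1 ≤ R → ∀ k : Fin 3 → ℝ,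
        (R : ℝ) ^ α * ∑' y : Site 3, m y * (1 - Real.cos (∑ i, k i * ((y i : ℝ) / R))) ≤
          (|C'| / 2 + 2 * |C|) * (1 + ∑ i, k i ^ 2) :=
  fun m α C C' R₁ hm hnn htail hbox R hR₁ hR k =>
    levyCT_symbol_le m α C C' R₁ hm hnn htail hbox R hR₁ hR k

end Summit.CriticalPhenomena.Ising3DConformalLimit.Cruxes.DirectCorrelationStableTail.DiffusiveBranchIsNonsaturation

end
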